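import Literature.Probability.RandomPlanarGeometry.HexSAWPolygonCellsStickDecomp
import Literature.Probability.RandomPlanarGeometry.HexSAWPolygonCellsDiag
import HarnessLib

/-!
# Cell calculus for honeycomb polygon surgery, XXVII: generic CLEAN-PORT lemmas in coordinates (UR-ports on the top row and on the second row, UL-ports,
# the port above the flipped hexagon)

Topic `Literature/Probability/RandomPlanarGeometry` (lane «pcv-sawmu», a-p4 g22; sequel of XII `…CellsStickDecomp` (`urIter`), VIII `…CellsDiag`).

For the port tables of «OMEGA» (LEMMA P of `HOME/pub-sawmu-a-p4/g21/omega/THEOREM-OMEGA-g21.md` §2) every base image `C` has all its hexagons on rows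
`≤ Y + 1`, with at most ONE hexagon `u` on row `Y + 1` (the flipped / leaf hexagon `UL c`).  In that situation the four kinds of ports are clean leaf spots with
a clear up-right ray under purely local, coordinate-checkable side conditions — this file proves that once, in the form `GoodPort C p q`
(`p ∉ C`, `nbrs p ∩ C = {q}`, the ray `UR^j p` (`j ≥ 1`) misses `C` and touches no hexagon of `C`), consumed field by field by XXII's `PortInv`:
`goodPort_ur_topRow` (p = `UR d`, `d` on row `Y`), `goodPort_ur_secondRow` (p = `UR d`, `d` on row `Y − 1` right of everything on row `Y`),
`goodPort_ul_topRow` (p = `UL d`, `d` on row `Y`, `L d ∉ C`), `goodPort_ur_apex` (p = `UR u`).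

Sources: N. Madras, G. Slade, *The Self-Avoiding Walk* (1993), §3.2, proof of Theorem 3.2.3 [MadrasSlade1993]; I. Jensen, J. Phys.: Conf. Ser. 42 (2006) 163
[Jensen2006HoneycombPolygons].  Label (lane): LANE INFRASTRUCTURE; nothing new in writing.
-/

open Finset

namespace Literature.Probability.RandomPlanarGeometry.SAW

namespace HexCell

/-- **A good port** `p` of the image `C` with contact `q`: a clean leaf spot whose up-right ray is clear.
[cite: MadrasSlade1993, §3.2 (proof of Theorem 3.2.3: re-attaching units at clean spots)] -/
structure GoodPort (C : Finset Cell) (p q : Cell) : Prop where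
  notMem : p ∉ C
  contacts : nbrs p ∩ C = {q}
  ray : ∀ j : ℕ, 1 ≤ j → urIter p j ∉ C
  clear : ∀ j : ℕ, 1 ≤ j → ∀ x ∈ C, x ∉ nbrs (urIter p j)

/-- Fields of a good port in the form used by `PortInv`. [cite: MadrasSlade1993, §3.2 (proof of Theorem 3.2.3)] -/
theorem GoodPort.urIter_notMem {C : Finset Cell} {p q : Cell} (h : GoodPort C p q) (j : ℕ) : urIter p j ∉ C := by
  rcases Nat.eq_zero_or_pos j with rfl | hj
  · rw [urIter_zero]; exact h.notMem
  · exact h.ray j hj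

/-- [cite: MadrasSlade1993, §3.2 (proof of Theorem 3.2.3)] -/
theorem GoodPort.card_contacts {C : Finset Cell} {p q : Cell} (h : GoodPort C p q) : #(nbrs p ∩ C) = 1 := by
  rw [h.contacts, card_singleton]

/-- Row profile of a base image: everything on rows `≤ Y + 1`, and on row `Y + 1` only abscissa `u1`.
[cite: MadrasSlade1993, §3.2 (proof of Theorem 3.2.3)] -/
def RowProfile (C : Finset Cell) (Y u1 : ℤ) : Prop := ∀ x ∈ C, x.2 ≤ Y + 1 ∧ (x.2 = Y + 1 → x.1 = u1)

/-- ★ **UR-port of a top-row hexagon.**  `d = (a, Y) ∈ C`, `(a+2, Y) ∉ C` (right end), and the row-`Y+1` abscissa `u1 ∉ {a−1, a+1, a+3}`: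
then `UR d = (a+1, Y+1)` is a good port with contact `d`. [cite: MadrasSlade1993, §3.2 (proof of Theorem 3.2.3)] -/
theorem goodPort_ur_topRow {C : Finset Cell} {Y u1 a : ℤ} (hC : RowProfile C Y u1) (hd : ((a, Y) : Cell) ∈ C)
    (hR : ((a + 2, Y) : Cell) ∉ C) (hu : u1 ≠ a - 1 ∧ u1 ≠ a + 1 ∧ u1 ≠ a + 3) :
    GoodPort C (UR (a, Y)) (a, Y) := by
  refine ⟨fun h => ?_, ?_, ?_, ?_⟩
  · exact hu.2.1 ((hC _ h).2 rfl).symm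
  · ext x
    simp only [mem_inter, mem_singleton, mem_nbrs_iff, UR_fst, UR_snd, Prod.ext_iff]
    constructor
    · rintro ⟨hx, hxC⟩
      have h1 := hC x hxC
      have h2 : ¬ (x.1 = a + 2 ∧ x.2 = Y) := fun e => hR (by rw [show ((a + 2, Y) : Cell) = x from Prod.ext e.1.symm e.2.symm]; exact hxC)
      omega
    · rintro ⟨h1, h2⟩
      refine ⟨by omega, ?_⟩
      rw [show x = (a, Y) from Prod.ext h1 h2]; exact hd
  · intro j hj h
    have := hC _ h; simp [urIter] at this; omega
  · intro j hj x hxC hx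
    have h1 := hC x hxC
    simp only [mem_nbrs_iff, urIter, UR_fst, UR_snd, Prod.ext_iff] at hx
    omega

/-- ★ **UR-port of a second-row hexagon.**  `d = (a, Y−1) ∈ C` with `(a+2, Y−1) ∉ C`, every row-`Y` hexagon of `C` at abscissa `< a − 1`, and `u1 < a`:
then `UR d = (a+1, Y)` is a good port with contact `d`. [cite: MadrasSlade1993, §3.2 (proof of Theorem 3.2.3)] -/
theorem goodPort_ur_secondRow {C : Finset Cell} {Y u1 a : ℤ} (hC : RowProfile C Y u1) (hd : ((a, Y - 1) : Cell) ∈ C)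
    (hR : ((a + 2, Y - 1) : Cell) ∉ C) (hrowY : ∀ x ∈ C, x.2 = Y → x.1 < a - 1) (hu : u1 < a) :
    GoodPort C (UR (a, Y - 1)) (a, Y - 1) := by
  refine ⟨fun h => ?_, ?_, ?_, ?_⟩
  · have := hrowY _ h (by simp); simp at this; omega
  · ext x
    simp only [mem_inter, mem_singleton, mem_nbrs_iff, UR_fst, UR_snd, Prod.ext_iff]
    constructor
    · rintro ⟨hx, hxC⟩
      have h1 := hC x hxC
      have h2 : ¬ (x.1 = a + 2 ∧ x.2 = Y - 1) :=
        fun e => hR (by rw [show ((a + 2, Y - 1) : Cell) = x from Prod.ext e.1.symm e.2.symm]; exact hxC)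
      have h3 : x.2 = Y → x.1 < a - 1 := hrowY x hxC
      omega
    · rintro ⟨h1, h2⟩
      refine ⟨by omega, ?_⟩
      rw [show x = (a, Y - 1) from Prod.ext h1 h2]; exact hd
  · intro j hj h
    have h1 := hC _ h
    have h3 := hrowY _ h
    simp [urIter] at h1 h3; omega
  · intro j hj x hxC hx
    have h1 := hC x hxC
    have h3 : x.2 = Y → x.1 < a - 1 := hrowY x hxC
    simp only [mem_nbrs_iff, urIter, UR_fst, UR_snd, Prod.ext_iff] at hx
    omega

/-- ★ **UL-port of a top-row hexagon.**  `d = (a, Y) ∈ C`, `(a−2, Y) ∉ C`, and `u1 ∉ {a−3, a−1, a+1}`: then `UL d = (a−1, Y+1)` is a good port with contact `d`.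
[cite: MadrasSlade1993, §3.2 (proof of Theorem 3.2.3)] -/
theorem goodPort_ul_topRow {C : Finset Cell} {Y u1 a : ℤ} (hC : RowProfile C Y u1) (hd : ((a, Y) : Cell) ∈ C)
    (hL : ((a - 2, Y) : Cell) ∉ C) (hu : u1 ≠ a - 3 ∧ u1 ≠ a - 1 ∧ u1 ≠ a + 1) :
    GoodPort C (UL (a, Y)) (a, Y) := by
  refine ⟨fun h => ?_, ?_, ?_, ?_⟩
  · exact hu.2.1 ((hC _ h).2 rfl).symm
  · ext x
    simp only [mem_inter, mem_singleton, mem_nbrs_iff, UL_fst, UL_snd, Prod.ext_iff]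
    constructor
    · rintro ⟨hx, hxC⟩
      have h1 := hC x hxC
      have h2 : ¬ (x.1 = a - 2 ∧ x.2 = Y) := fun e => hL (by rw [show ((a - 2, Y) : Cell) = x from Prod.ext e.1.symm e.2.symm]; exact hxC)
      omega
    · rintro ⟨h1, h2⟩
      refine ⟨by omega, ?_⟩
      rw [show x = (a, Y) from Prod.ext h1 h2]; exact hd
  · intro j hj h
    have := hC _ h; simp [urIter] at this; omega
  · intro j hj x hxC hx
    have h1 := hC x hxC
    simp only [mem_nbrs_iff, urIter, UL_fst, UL_snd, Prod.ext_iff] at hx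
    omega

/-- ★ **The port above the flipped / leaf hexagon** `u = (u1, Y+1) ∈ C`: `UR u = (u1+1, Y+2)` is a good port with contact `u`.
[cite: MadrasSlade1993, §3.2 (proof of Theorem 3.2.3)] -/
theorem goodPort_ur_apex {C : Finset Cell} {Y u1 : ℤ} (hC : RowProfile C Y u1) (hu : ((u1, Y + 1) : Cell) ∈ C) :
    GoodPort C (UR (u1, Y + 1)) (u1, Y + 1) := by
  refine ⟨fun h => ?_, ?_, ?_, ?_⟩
  · have := (hC _ h).1; simp only [UR_snd] at this; omega
  · ext x
    simp only [mem_inter, mem_singleton, mem_nbrs_iff, UR_fst, UR_snd, Prod.ext_iff]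
    constructor
    · rintro ⟨hx, hxC⟩
      have h1 := hC x hxC
      omega
    · rintro ⟨h1, h2⟩
      refine ⟨by omega, ?_⟩
      rw [show x = (u1, Y + 1) from Prod.ext h1 h2]; exact hu
  · intro j hj h
    have := hC _ h; simp [urIter] at this; omega
  · intro j hj x hxC hx
    have h1 := hC x hxC
    simp only [mem_nbrs_iff, urIter, UR_fst, UR_snd, Prod.ext_iff] at hx
    omega

/-! ### Diagonals of the four port kinds -/

/-- [cite: Jensen2006HoneycombPolygons, §2] -/
@[simp] theorem diag_ul (c : Cell) : diag (UL c) = diag c - 2 := by show c.1 - 1 - (c.2 + 1) = c.1 - c.2 - 2; ring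

/-- [cite: Jensen2006HoneycombPolygons, §2] -/
theorem diag_mk (x y : ℤ) : diag (x, y) = x - y := rfl

end HexCell

end Literature.Probability.RandomPlanarGeometry.SAW
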